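/-
Copyright: statement-level skeleton of a published paper (lit-balaban cell, Phase-2 proof seat p10, gen 2). No proof claims
beyond what the kernel checks below.
-/
import Mathlib
import Literature.MathematicalPhysics.QuantumFieldTheory.BalabanImbrieJaffe1984to88.BIJ85MomentumSymbols71
import Literature.MathematicalPhysics.QuantumFieldTheory.BalabanImbrieJaffe1984to88.BIJ85CurlComplement719

/-!
# `BalabanImbrieJaffe1984to88.BIJ85Tau0Positivity729` — T. Bałaban, J. Imbrie, A. Jaffe, *Renormalization of the Higgs
model: minimizers, propagators and the stability of mean field theory*, Commun. Math. Phys. **97** (1985) 299–329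
[BalabanImbrieJaffe1985]: Sect. 7.1 pp. 322–325 — the l-terms of τ₁ (7.1.14) and τ₀, and the end of the proof of Theorem
7.1.1: **(7.1.28) τ₀ ≤ τ₁, (7.1.29), (7.1.30) ε ≤ τ₀↾(∂𝒦)^⊥ with an explicit ε — PROVED**

statement-level skeleton of published theorems with citation tags; proofs where landed; nothing here is a claim about
the Yang–Mills mass gap

PDF held: `paper:balaban1985-cmp97-bij-higgs-minimizers` (journal page = PDF page + 298).  Renders read as images: PDF pp. 24–27
(journal 322–325), poppler renders in the seat folder (`renders/c2-p024…p027.png`).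

CITATION HEADER (lean-in-tree rule).  Part of the lit-balaban TYPED SKELETON (HOME `run/shared/lean/pub/lit-balaban/`); WHAT IS
REPRODUCED: SKELETON rows **C1.Eq7.1.13-7.1.19** (the (7.1.14) l-terms) and **C1.Eq7.1.28-7.1.31** ((7.1.28)–(7.1.30)) of
`HOME/lit-balaban-r15/ROWS-C1.md` (fold owner r15, referee ref-5), over r15's CONCRETE momentum symbols
`BIJ85MomentumSymbols71` ((7.1.3) `tensorInner`, (7.1.4) `dSym`, (7.1.5) `dOne`, (7.1.7) `vSym`, (7.1.9) `uSym`, (7.1.10)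
`lShifts`/`shiftMom`) and the sibling `BIJ85CurlComplement719` ((7.1.19b), (∂𝒦)^⊥, the bracket `projK`).
* **(7.1.14)** p. 322: `lKernel u v ∂` = the generic l-term (|u|²/(v̄_μv̄_νv_λv_κ))[δ_{μλ} − ∂_μ∂̄_λ/Δ][δ_{νκ} − ∂_ν∂̄_κ/Δ] as a
  function of the values at p′ + l — r15's concrete `tau1Term η q` IS it at the symbols u(q), v(q), ∂(q)
  (`tau1Term_eq_lKernel`, `projSym_eq_projK`), and r15's `tau1Sym η M p′` = ½Σ_l is the printed τ₁(p′); `tau0 η p` :=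
  ½·tau1Term η p (p. 324: *"Introduce the operator τ₀(p) obtained by restricting the sum in (7.1.14) to l = 0"*); the closed
  shape ⟨f, (l-term) f⟩ = |u|²·ḡ·(P ⊗ P)g, g = f/(vv) (`tensorInner_lKernel`, p. 323 *"tensor products of projection operators"*).
* **(7.1.28)** p. 325 *"each term in the sum over l is a nonnegative operator. Hence τ₀(p) ≤ τ₁(p)"* — PROVED
  (`tensorInner_lKernel_eq_normSq`, `tensorInner_tau1Term_nonneg`, `ineq7128`).
* **(7.1.29)** *"⟨f^⊥,τ₀f^⊥⟩ = ½|u(p)|²Σ_{μ,ν}|f^⊥_{μν}(p)/(v_μ(p)v_ν(p))|²"* — PROVED for every two-form in (∂𝒦(p))^⊥ (`eq7129`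
  generic l-term data; `eq7129_tau0` the τ₀(p) of the typed symbols at 0 < |p_i| ≤ π).
* **(7.1.30)** *"From (7.1.20) we then infer ε ≤ τ₀↾(∂𝒦)^⊥, for some ε > 0"* — PROVED with the EXPLICIT ε = ½(2/π)^{2d+4},
  independent of k, p, η (`eps730`, `ineq7130_of_bounds`, `ineq7130`): the first conjunct of hypothesis (7.1.21) of Proposition
  7.1.2 (`BIJ85Sect7Statements.Ineq7121`) verified fibrewise for the τ₀ of (7.1.14); with (7.1.20) for the typed v_μ
  (`norm_vSym_bounds`, from r15's `norm_vSym` + `BIJ85Eq7120.ineq7120`), |u| bounds (`norm_uSym_bounds`) and the eigenvalue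
  relation ∂^{(1)}_μ = v_μ∂_μ (`dOne_eq_vSym_mul_dSym`).  CONVENTION NOTE: the typed v_μ(p) = ∂^{(1)}_μ(p′)/∂_μ(p) is the junk
  value 0/0 = 0 at p_μ = 0, where print has 1 by continuity; the concrete statements therefore take 0 < |p_i| ≤ π, and the
  generic ones (`eq7129`, `ineq7130_of_bounds`) cover any eigenvalue data obeying (7.1.20).
NOT here (instance's / not claimed): the derivation of (7.1.14)–(7.1.16) from [6I] (1.83)–(1.84) (p. 322 *"by straightforward,
algebraic manipulation"*); τ₂ (7.1.15)–(7.1.16), 0 ≤ τ₂ and ‖τ₂‖ ≤ M (7.1.23)–(7.1.24); the existence half of (7.1.19a); the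
explicit Δ_k formula of p. 325 and its bound *"bounded below by ε‖∂B‖² (see also [6I, 8])"*.  Unit `lit-balaban-p10`
(gen 2), HOME as above.
-/

namespace Literature.MathematicalPhysics.QuantumFieldTheory.BalabanImbrieJaffe1984to88.BIJ85Tau0Positivity729

open scoped BigOperators Real ComplexConjugate Matrix Kronecker
open Finset Matrix
open Literature.MathematicalPhysics.QuantumFieldTheory.BalabanImbrieJaffe1984to88.BIJ85MomentumSymbols71
open Literature.MathematicalPhysics.QuantumFieldTheory.BalabanImbrieJaffe1984to88.BIJ85CurlComplement719

noncomputable section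

variable {d : ℕ}

/-! ## (7.1.14): the l-terms of τ₁, and τ₀ -/

/-- **(7.1.14)** p. 322 [PDF 24], verbatim: *"Explicitly τ_{1,μνλκ}(p′) = ½Σ_l (|u|²/(v̄_μv̄_νv_λv_κ) [δ_{μλ} − ∂_μ∂̄_λ/Δ]
[δ_{νκ} − ∂_ν∂̄_κ/Δ])(p′ + l), (7.1.14)"*; p. 323: *"In the formula for τ₁(p′), each term on the right side is evaluated at
momentum p′ + l."* — the l-term (without the overall ½) as a function of GENERIC values u = u(p′+l) ∈ ℂ, v = (v_μ(p′+l))_μ,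
∂ = (∂_μ(p′+l))_μ ∈ ℂ^d (bracket = `BIJ85CurlComplement719.projK ∂`); r15's concrete `BIJ85MomentumSymbols71.tau1Term η q` IS
this kernel at the symbols u(q), v(q), ∂(q) (`tau1Term_eq_lKernel`). [cite: BalabanImbrieJaffe1985, (7.1.14) p.322] -/
def lKernel (u : ℂ) (v e : Fin d → ℂ) : Fin d → Fin d → Fin d → Fin d → ℂ :=
  fun μ ν l κ => (((‖u‖ ^ 2 : ℝ)) : ℂ) / (conj (v μ) * conj (v ν) * v l * v κ) * (projK e μ l * projK e ν κ)

/-- **(7.1.14)**: r15's concrete bracket `projSym η q` is the generic bracket `projK` at ∂ = ∂(q).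
[cite: BalabanImbrieJaffe1985, (7.1.14) p.322] -/
theorem projSym_eq_projK (η : ℝ) (q : Fin d → ℝ) (μ l : Fin d) : projSym η q μ l = projK (dSym η q) μ l := by
  rw [projSym, projK_apply, lapSym]

/-- **(7.1.14)**: r15's concrete l-term `tau1Term η q` is `lKernel` at the symbols u(q) (7.1.9), v(q) (7.1.7), ∂(q) (7.1.4).
[cite: BalabanImbrieJaffe1985, (7.1.14) p.322] -/
theorem tau1Term_eq_lKernel (η : ℝ) (q : Fin d → ℝ) :
    tau1Term η q = lKernel (uSym η q) (vSym η q) (dSym η q) := by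
  funext μ ν l κ
  rw [tau1Term, lKernel, projSym_eq_projK, projSym_eq_projK]

/-- p. 324 [PDF 26], verbatim: *"Let us now prove the lower bound (7.1.21) on τ₀(p). Introduce the operator τ₀(p) obtained by
restricting the sum in (7.1.14) to l = 0."* — τ₀(p) = ½·(the l = 0 term) of r15's `tau1Sym` (7.1.14).
[cite: BalabanImbrieJaffe1985, (7.1.28) p.325] -/
def tau0 (η : ℝ) (p : Fin d → ℝ) : Fin d → Fin d → Fin d → Fin d → ℂ :=
  fun μ ν l κ => (1 / 2 : ℂ) * tau1Term η p μ ν l κ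

/-- The unit-lattice curl components of r15's `curlOne` are the generic curls `BIJ85CurlComplement719.curlP` at ∂^{(1)}(p′).
[cite: BalabanImbrieJaffe1985, (7.1.19) p.323] -/
theorem curlOne_eq_curlP (p' : Fin d → ℝ) (B : Fin d → ℂ) : curlOne p' B = curlP (dOne p') B := rfl

/-- kernel: a two-form as a vector indexed by pairs. [folklore] -/
private def vec2 (g : Fin d → Fin d → ℂ) : Fin d × Fin d → ℂ := fun i => g i.1 i.2

/-- The form of one l-term in closed shape: ⟨f, T f⟩ = |u|² · \overline{g} · (P ⊗ P)g with g = f/(vv), P the bracket — the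
"tensor products of projection operators" of p. 323. [cite: BalabanImbrieJaffe1985, (7.1.14) p.322] -/
theorem tensorInner_lKernel (u : ℂ) (v e : Fin d → ℂ) (f : Fin d → Fin d → ℂ) :
    tensorInner f (lKernel u v e) f = (((‖u‖ ^ 2 : ℝ)) : ℂ) *
      ∑ μ, ∑ ν, conj (gOf v f μ ν) * ∑ l, ∑ κ, projK e μ l * projK e ν κ * gOf v f l κ := by
  unfold tensorInner lKernel gOf
  simp only [Finset.mul_sum, map_div₀, map_mul]
  refine Finset.sum_congr rfl fun μ _ => Finset.sum_congr rfl fun ν _ => Finset.sum_congr rfl fun l _ =>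
    Finset.sum_congr rfl fun κ _ => ?_
  by_cases hμ : v μ = 0
  · simp [hμ]
  by_cases hν : v ν = 0
  · simp [hν]
  by_cases hl : v l = 0
  · simp [hl]
  by_cases hκ : v κ = 0
  · simp [hκ]
  have : conj (v μ) ≠ 0 := (map_ne_zero _).mpr hμ
  have : conj (v ν) ≠ 0 := (map_ne_zero _).mpr hν
  field_simp

/-- kernel: for a self-adjoint idempotent matrix M, x̄·(Mx) = |Mx|² ≥ 0. [folklore] -/
private theorem star_dot_mulVec_of_proj {ι : Type*} [Fintype ι] [DecidableEq ι] (M : Matrix ι ι ℂ) (hM : Mᴴ = M)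
    (hM2 : M * M = M) (x : ι → ℂ) :
    star x ⬝ᵥ (M *ᵥ x) = ((∑ i, ‖(M *ᵥ x) i‖ ^ 2 : ℝ) : ℂ) := by
  have h : star x ⬝ᵥ (M *ᵥ x) = star (M *ᵥ x) ⬝ᵥ (M *ᵥ x) := by
    rw [Matrix.star_mulVec, hM, ← Matrix.dotProduct_mulVec, Matrix.mulVec_mulVec, hM2]
  rw [h]
  simp only [dotProduct, Pi.star_apply, Complex.star_def, Complex.conj_mul']
  push_cast
  rfl

/-- kernel: the double sum of `tensorInner_lKernel` is x̄·((P ⊗ P)x) for x = g as a vector on pairs. [folklore] -/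
private theorem sum_eq_kronecker (P : Matrix (Fin d) (Fin d) ℂ) (g : Fin d → Fin d → ℂ) :
    ∑ μ, ∑ ν, conj (g μ ν) * ∑ l, ∑ κ, P μ l * P ν κ * g l κ =
      star (vec2 g) ⬝ᵥ ((P ⊗ₖ P) *ᵥ vec2 g) := by
  rw [dotProduct, Fintype.sum_prod_type]
  refine Finset.sum_congr rfl fun μ _ => Finset.sum_congr rfl fun ν _ => ?_
  rw [Pi.star_apply, Complex.star_def, Matrix.mulVec, dotProduct, Fintype.sum_prod_type]
  simp only [vec2, Matrix.kroneckerMap_apply]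

/-- kernel: P ⊗ P is again a self-adjoint idempotent. [folklore] -/
private theorem kronecker_proj (e : Fin d → ℂ) :
    (projK e ⊗ₖ projK e)ᴴ = projK e ⊗ₖ projK e ∧ (projK e ⊗ₖ projK e) * (projK e ⊗ₖ projK e) = projK e ⊗ₖ projK e := by
  constructor
  · rw [Matrix.conjTranspose_kronecker, projK_conjTranspose]
  · rw [← Matrix.mul_kronecker_mul, projK_mul_projK]

/-- p. 325 [PDF 27], verbatim: *"Clearly each term in the sum over l is a nonnegative operator."* — PROVED: the form of every
l-term is the nonnegative real number |u|²·|(P ⊗ P)g|², g = f/(vv). [cite: BalabanImbrieJaffe1985, (7.1.28) p.325] -/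
theorem tensorInner_lKernel_eq_normSq (u : ℂ) (v e : Fin d → ℂ) (f : Fin d → Fin d → ℂ) :
    tensorInner f (lKernel u v e) f =
      ((‖u‖ ^ 2 * ∑ i : Fin d × Fin d, ‖((projK e ⊗ₖ projK e) *ᵥ vec2 (gOf v f)) i‖ ^ 2 : ℝ) : ℂ) := by
  rw [tensorInner_lKernel, sum_eq_kronecker, star_dot_mulVec_of_proj _ (kronecker_proj e).1 (kronecker_proj e).2]
  push_cast
  ring

/-- **(7.1.28)**, the nonnegativity of each l-term, PROVED: 0 ≤ ⟨f, (l-term) f⟩, a real number — for generic data and for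
r15's concrete `tau1Term η q` at every fine momentum q. [cite: BalabanImbrieJaffe1985, (7.1.28) p.325] -/
theorem tensorInner_lKernel_nonneg (u : ℂ) (v e : Fin d → ℂ) (f : Fin d → Fin d → ℂ) :
    0 ≤ (tensorInner f (lKernel u v e) f).re ∧ (tensorInner f (lKernel u v e) f).im = 0 := by
  rw [tensorInner_lKernel_eq_normSq, Complex.ofReal_re, Complex.ofReal_im]
  exact ⟨by positivity, rfl⟩

/-- **(7.1.28)** for r15's concrete l-term: 0 ≤ ⟨f, tau1Term(q) f⟩ ∈ ℝ at every fine momentum q.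
[cite: BalabanImbrieJaffe1985, (7.1.28) p.325] -/
theorem tensorInner_tau1Term_nonneg (η : ℝ) (q : Fin d → ℝ) (f : Fin d → Fin d → ℂ) :
    0 ≤ (tensorInner f (tau1Term η q) f).re ∧ (tensorInner f (tau1Term η q) f).im = 0 := by
  rw [tau1Term_eq_lKernel]
  exact tensorInner_lKernel_nonneg _ _ _ f

/-- kernel: `tensorInner` is additive in the kernel over a finite sum. [folklore] -/
private theorem tensorInner_sum {ι : Type*} (s : Finset ι) (K : ι → Fin d → Fin d → Fin d → Fin d → ℂ)
    (f : Fin d → Fin d → ℂ) :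
    tensorInner f (fun μ ν l κ => ∑ i ∈ s, K i μ ν l κ) f = ∑ i ∈ s, tensorInner f (K i) f := by
  classical
  induction s using Finset.induction_on with
  | empty => simp [tensorInner]
  | @insert a s ha ih =>
    unfold tensorInner at ih ⊢
    simp only [Finset.sum_insert ha, mul_add, add_mul, Finset.sum_add_distrib, ih]

/-- kernel: `tensorInner` is homogeneous in the kernel. [folklore] -/
private theorem tensorInner_const_mul (c : ℂ) (K : Fin d → Fin d → Fin d → Fin d → ℂ) (f : Fin d → Fin d → ℂ) :
    tensorInner f (fun μ ν l κ => c * K μ ν l κ) f = c * tensorInner f K f := by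
  unfold tensorInner
  simp only [Finset.mul_sum]
  exact Finset.sum_congr rfl fun μ _ => Finset.sum_congr rfl fun ν _ => Finset.sum_congr rfl fun l _ =>
    Finset.sum_congr rfl fun κ _ => by ring

/-- ⟨f, τ₀(p)f⟩ = ½⟨f, (l = 0 term) f⟩ and ⟨f, τ₁(p′)f⟩ = ½Σ_l ⟨f, (l-term) f⟩ (linearity of (7.1.3) in the kernel).
[cite: BalabanImbrieJaffe1985, (7.1.14) p.322] -/
theorem tensorInner_tau0 (η : ℝ) (p : Fin d → ℝ) (f : Fin d → Fin d → ℂ) :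
    tensorInner f (tau0 η p) f = (1 / 2 : ℂ) * tensorInner f (tau1Term η p) f :=
  tensorInner_const_mul _ _ f

/-- ⟨f, τ₁(p′)f⟩ = ½ Σ_{l} ⟨f, (l-term)(p′+l) f⟩. [cite: BalabanImbrieJaffe1985, (7.1.14) p.322] -/
theorem tensorInner_tau1Sym (η : ℝ) (M : ℕ) (p' : Fin d → ℝ) (f : Fin d → Fin d → ℂ) :
    tensorInner f (tau1Sym η M p') f =
      (1 / 2 : ℂ) * ∑ m ∈ lShifts d M, tensorInner f (tau1Term η (shiftMom p' m)) f := by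
  rw [← tensorInner_sum, ← tensorInner_const_mul]
  rfl

/-- **(7.1.28)** p. 325 [PDF 27], verbatim: *"Clearly each term in the sum over l is a nonnegative operator. Hence τ₀(p) ≤ τ₁(p).
(7.1.28)"* — PROVED as the form inequality ⟨f,τ₀(p′)f⟩ ≤ ⟨f,τ₁(p′)f⟩ for every f (both sides real; τ₁ = r15's `tau1Sym η M`,
any η and cut-off M). [cite: BalabanImbrieJaffe1985, (7.1.28) p.325] -/
theorem ineq7128 (η : ℝ) (M : ℕ) (p' : Fin d → ℝ) (f : Fin d → Fin d → ℂ) :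
    (tensorInner f (tau0 η p') f).re ≤ (tensorInner f (tau1Sym η M p') f).re := by
  have h12 : (1 / 2 : ℂ) = ((1 / 2 : ℝ) : ℂ) := by norm_num
  rw [tensorInner_tau0, tensorInner_tau1Sym, h12, Complex.re_ofReal_mul, Complex.re_ofReal_mul,
    Complex.re_sum (lShifts d M) (fun m => tensorInner f (tau1Term η (shiftMom p' m)) f),
    ← Finset.add_sum_erase (lShifts d M) (fun m => (tensorInner f (tau1Term η (shiftMom p' m)) f).re)
      (zero_mem_lShifts d M), shiftMom_zero]
  have hnn : ∀ m ∈ (lShifts d M).erase 0, 0 ≤ (tensorInner f (tau1Term η (shiftMom p' m)) f).re :=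
    fun m _ => (tensorInner_tau1Term_nonneg η _ f).1
  have := Finset.sum_nonneg hnn
  linarith

/-- kernel: (P ⊗ P) acting on g as a vector on pairs is P g Pᵀ. [folklore] -/
private theorem kron_mulVec_vec2 (P : Matrix (Fin d) (Fin d) ℂ) (g : Fin d → Fin d → ℂ) :
    (P ⊗ₖ P) *ᵥ vec2 g = vec2 (fun μ ν => (P * Matrix.of g * Pᵀ) μ ν) := by
  funext i
  obtain ⟨μ, ν⟩ := i
  simp only [vec2, Matrix.mulVec, dotProduct, Fintype.sum_prod_type, Matrix.kroneckerMap_apply, Matrix.mul_apply,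
    Matrix.of_apply, Matrix.transpose_apply, Finset.sum_mul]
  rw [Finset.sum_comm]
  refine Finset.sum_congr rfl fun κ _ => Finset.sum_congr rfl fun l _ => ?_
  ring

/-- kernel: on such g the bracket acts as the identity on both indices: (P ⊗ P)g = g. [folklore] -/
private theorem kronecker_projK_mulVec_eq_self {v e : Fin d → ℂ} {f : Fin d → Fin d → ℂ} (hf : IsTwoForm f)
    (hv : ∀ μ, v μ ≠ 0) (hperp : PerpCurl (fun μ => v μ * e μ) v f) :
    (projK e ⊗ₖ projK e) *ᵥ vec2 (gOf v f) = vec2 (gOf v f) := by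
  have hdiv := div_eq_zero_of_perp hf hv hperp
  -- g is antisymmetric, so the row divergence also vanishes
  have hg : ∀ μ ν, gOf v f ν μ = -gOf v f μ ν := by
    intro μ ν; unfold gOf; rw [hf μ ν, mul_comm (v ν)]; ring
  have hdiv' : ∀ μ, ∑ κ, gOf v f μ κ * conj (e κ) = 0 := by
    intro μ
    calc ∑ κ, gOf v f μ κ * conj (e κ) = -∑ κ, conj (e κ) * gOf v f κ μ := by
          rw [← Finset.sum_neg_distrib]
          exact Finset.sum_congr rfl fun κ _ => by rw [hg κ μ]; ring
      _ = 0 := by rw [hdiv μ, neg_zero]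
  rw [kron_mulVec_vec2, Matrix.mul_assoc, of_mul_projK_transpose hdiv', projK_mul_of hdiv]
  rfl

/-- **(7.1.29)** p. 325 [PDF 27], verbatim: *"Note that because f^⊥ is defined with respect to the inner product (7.1.19b), τ₀
simplifies on f^⊥. In particular the ∂ terms vanish and ⟨f^⊥, τ₀f^⊥⟩ = ½|u(p)|² Σ_{μ,ν} |f^⊥_{μν}(p)/(v_μ(p)v_ν(p))|². (7.1.29)"*
— the l-term identity behind it, PROVED for generic data (u, v, ∂) with no v_μ = 0 and every two-form f in (∂𝒦(p))^⊥,
curls taken with ∂^{(1)}_μ = v_μ∂_μ (the eigenvalue relation (7.1.7)): ⟨f, (l-term) f⟩ = |u|² Σ_{μ,ν} |f_{μν}/(v_μv_ν)|² (τ₀ is ½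
of the l = 0 term: `eq7129_tau0`). [cite: BalabanImbrieJaffe1985, (7.1.29) p.325] -/
theorem eq7129 {u : ℂ} {v e : Fin d → ℂ} {f : Fin d → Fin d → ℂ} (hf : IsTwoForm f) (hv : ∀ μ, v μ ≠ 0)
    (hperp : PerpCurl (fun μ => v μ * e μ) v f) :
    tensorInner f (lKernel u v e) f = ((‖u‖ ^ 2 * ∑ μ, ∑ ν, ‖f μ ν / (v μ * v ν)‖ ^ 2 : ℝ) : ℂ) := by
  rw [tensorInner_lKernel_eq_normSq, kronecker_projK_mulVec_eq_self hf hv hperp, Fintype.sum_prod_type]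
  rfl

/-- **(7.1.20)** for the typed eigenvalue `BIJ85MomentumSymbols71.vSym` (p. 323: *"for |p_i| ≤ π, 2/π ≤ |v_μ(p)| ≤ π/2.
(7.1.20)"*), PROVED for 0 < |p_μ| ≤ π, 0 < η ≤ 1 from r15's `norm_vSym` and `BIJ85Eq7120.ineq7120` (at p_μ = 0 the typed
quotient ∂^{(1)}_μ(p′)/∂_μ(p) is 0/0, where print has the value 1 by continuity — hence the hypothesis p_μ ≠ 0 below).
[cite: BalabanImbrieJaffe1985, (7.1.20) p.323] -/
theorem norm_vSym_bounds {η : ℝ} (hη0 : 0 < η) (hη1 : η ≤ 1) {p : Fin d → ℝ} {μ : Fin d} (hp0 : p μ ≠ 0)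
    (hp : |p μ| ≤ π) : 2 / π ≤ ‖vSym η p μ‖ ∧ ‖vSym η p μ‖ ≤ π / 2 := by
  rw [norm_vSym hη0 hη1 p μ hp0 hp]
  exact BIJ85Eq7120.ineq7120 hη0 hη1 hp0 hp

/-- **(7.1.9)/(7.1.20)**: (2/π)^d ≤ |u(p)| ≤ (π/2)^d for 0 < |p_i| ≤ π, 0 < η ≤ 1, PROVED.
[cite: BalabanImbrieJaffe1985, (7.1.9) p.322] -/
theorem norm_uSym_bounds {η : ℝ} (hη0 : 0 < η) (hη1 : η ≤ 1) {p : Fin d → ℝ} (hp0 : ∀ μ, p μ ≠ 0)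
    (hp : ∀ μ, |p μ| ≤ π) : (2 / π) ^ d ≤ ‖uSym η p‖ ∧ ‖uSym η p‖ ≤ (π / 2) ^ d := by
  rw [uSym_eq_prod, norm_prod]
  constructor
  · calc (2 / π) ^ d = ∏ _μ : Fin d, (2 / π) := by rw [Finset.prod_const, Finset.card_univ, Fintype.card_fin]
      _ ≤ ∏ μ, ‖vSym η p μ‖ :=
        Finset.prod_le_prod (fun _ _ => by positivity) fun μ _ => (norm_vSym_bounds hη0 hη1 (hp0 μ) (hp μ)).1
  · calc ∏ μ, ‖vSym η p μ‖ ≤ ∏ _μ : Fin d, (π / 2) :=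
          Finset.prod_le_prod (fun _ _ => norm_nonneg _) fun μ _ => (norm_vSym_bounds hη0 hη1 (hp0 μ) (hp μ)).2
      _ = (π / 2) ^ d := by rw [Finset.prod_const, Finset.card_univ, Fintype.card_fin]

/-- **(7.1.7)**, PROVED: the eigenvalue relation ∂^{(1)}_μ(p) = v_μ(p)∂_μ(p) wherever p_μ ≠ 0, |p_μ| ≤ π (0 < η ≤ 1).
[cite: BalabanImbrieJaffe1985, (7.1.7) p.322] -/
theorem dOne_eq_vSym_mul_dSym {η : ℝ} (hη0 : 0 < η) (hη1 : η ≤ 1) {p : Fin d → ℝ} {μ : Fin d} (hp0 : p μ ≠ 0)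
    (hp : |p μ| ≤ π) : dOne p μ = vSym η p μ * dSym η p μ := by
  have hv0 : vSym η p μ ≠ 0 := fun h => by
    have := (norm_vSym_bounds hη0 hη1 hp0 hp).1
    rw [h, norm_zero] at this
    linarith [div_pos two_pos Real.pi_pos]
  have hd : dSym η p μ ≠ 0 := fun h => hv0 (by rw [vSym, h, div_zero])
  rw [vSym_eq, div_mul_cancel₀ _ hd]

/-- **(7.1.29)** for the τ₀(p) of p. 324 itself (0 < |p_i| ≤ π, 0 < η ≤ 1, curls with the unit-lattice symbol ∂^{(1)}(p) of
(7.1.5)), PROVED.  (At momenta with some p_μ = 0 the typed v_μ is the junk value 0/0; there the generic `eq7129` applies to the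
continuously extended data.) [cite: BalabanImbrieJaffe1985, (7.1.29) p.325] -/
theorem eq7129_tau0 {η : ℝ} (hη0 : 0 < η) (hη1 : η ≤ 1) {p : Fin d → ℝ} (hp0 : ∀ μ, p μ ≠ 0) (hp : ∀ μ, |p μ| ≤ π)
    {f : Fin d → Fin d → ℂ} (hf : IsTwoForm f) (hperp : PerpCurl (dOne p) (vSym η p) f) :
    tensorInner f (tau0 η p) f =
      ((1 / 2 * ‖uSym η p‖ ^ 2 * ∑ μ, ∑ ν, ‖f μ ν / (vSym η p μ * vSym η p ν)‖ ^ 2 : ℝ) : ℂ) := by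
  have hv : ∀ μ, vSym η p μ ≠ 0 := fun μ h => by
    have := (norm_vSym_bounds hη0 hη1 (hp0 μ) (hp μ)).1
    rw [h, norm_zero] at this
    linarith [div_pos two_pos Real.pi_pos]
  have hd1 : dOne p = fun μ => vSym η p μ * dSym η p μ := by
    funext μ; exact dOne_eq_vSym_mul_dSym hη0 hη1 (hp0 μ) (hp μ)
  rw [hd1] at hperp
  rw [tensorInner_tau0, tau1Term_eq_lKernel, eq7129 hf hv hperp]
  push_cast
  ring

/-- The explicit ε of (7.1.30): ε = ½(2/π)^{2d+4} (from (7.1.20): |u(p)|² ≥ (2/π)^{2d}, |v_μv_ν|^{−2} ≥ (2/π)⁴).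
[cite: BalabanImbrieJaffe1985, (7.1.30) p.325] -/
def eps730 (d : ℕ) : ℝ :=
  1 / 2 * (2 / π) ^ (2 * d + 4)

/-- ε > 0. [cite: BalabanImbrieJaffe1985, (7.1.30) p.325] -/
theorem eps730_pos (d : ℕ) : 0 < eps730 d := by
  unfold eps730; positivity

/-- **(7.1.30)** p. 325 [PDF 27], verbatim: *"From (7.1.20) we then infer ε ≤ τ₀↾(∂𝒦)^⊥, for some ε > 0, which with (7.1.28)
yields the desired lower bound ε ≤ τ₁↾(∂𝒦)^⊥. (7.1.30)"* — the τ₀ statement PROVED with the explicit ε = ½(2/π)^{2d+4}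
(independent of k, p and η), for the generic l-term data: any u with |u| ≥ (2/π)^d and eigenvalues v obeying (7.1.20)
(this form also covers the momenta with a vanishing component, where print extends v_μ = 1 by continuity), every two-form f in
(∂𝒦(p))^⊥ (curls with ∂^{(1)}_μ = v_μ∂_μ): 2ε‖f‖² ≤ ⟨f, (l-term) f⟩, i.e. ε‖f‖² ≤ ⟨f, ½(l-term) f⟩ = ⟨f, τ₀f⟩.  This is the
first conjunct of hypothesis (7.1.21) of Proposition 7.1.2 (`BIJ85Sect7Statements.Ineq7121`) for the τ₀ of (7.1.14).
[cite: BalabanImbrieJaffe1985, (7.1.30) p.325] -/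
theorem ineq7130_of_bounds {u : ℂ} {v e : Fin d → ℂ} (hv : ∀ μ, 2 / π ≤ ‖v μ‖ ∧ ‖v μ‖ ≤ π / 2)
    (hu : (2 / π) ^ d ≤ ‖u‖) {f : Fin d → Fin d → ℂ} (hf : IsTwoForm f) (hperp : PerpCurl (fun μ => v μ * e μ) v f) :
    2 * eps730 d * normSq f ≤ (tensorInner f (lKernel u v e) f).re := by
  have h2π : 0 < 2 / π := by positivity
  have hv0 : ∀ μ, v μ ≠ 0 := fun μ h => by
    have := (hv μ).1; rw [h, norm_zero] at this; linarith
  rw [eq7129 hf hv0 hperp, Complex.ofReal_re, eps730, normSq]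
  -- |u|² ≥ (2/π)^{2d}
  have hu2 : (2 / π) ^ (2 * d) ≤ ‖u‖ ^ 2 := by
    rw [pow_mul']; exact pow_le_pow_left₀ (by positivity) hu 2
  -- each term: |f/(v_μ v_ν)|² ≥ (2/π)⁴ |f|²
  have hterm : ∀ μ ν, (2 / π) ^ 4 * ‖f μ ν‖ ^ 2 ≤ ‖f μ ν / (v μ * v ν)‖ ^ 2 := by
    intro μ ν
    have hpos : 0 < ‖v μ‖ * ‖v ν‖ := mul_pos (h2π.trans_le (hv μ).1) (h2π.trans_le (hv ν).1)
    rw [norm_div, norm_mul, div_pow ‖f μ ν‖, le_div_iff₀ (by positivity)]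
    have hup : (‖v μ‖ * ‖v ν‖) ^ 2 ≤ ((π / 2) * (π / 2)) ^ 2 :=
      pow_le_pow_left₀ hpos.le (mul_le_mul (hv μ).2 (hv ν).2 (norm_nonneg _) (by positivity)) 2
    calc (2 / π) ^ 4 * ‖f μ ν‖ ^ 2 * (‖v μ‖ * ‖v ν‖) ^ 2
        ≤ (2 / π) ^ 4 * ‖f μ ν‖ ^ 2 * ((π / 2) * (π / 2)) ^ 2 := mul_le_mul_of_nonneg_left hup (by positivity)
      _ = ‖f μ ν‖ ^ 2 := by field_simp
  have hsum : (2 / π) ^ 4 * ∑ μ, ∑ ν, ‖f μ ν‖ ^ 2 ≤ ∑ μ, ∑ ν, ‖f μ ν / (v μ * v ν)‖ ^ 2 := by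
    rw [Finset.mul_sum]
    exact Finset.sum_le_sum fun μ _ => by
      rw [Finset.mul_sum]; exact Finset.sum_le_sum fun ν _ => hterm μ ν
  have hS : 0 ≤ ∑ μ, ∑ ν, ‖f μ ν‖ ^ 2 := Finset.sum_nonneg fun _ _ => Finset.sum_nonneg fun _ _ => sq_nonneg _
  calc 2 * (1 / 2 * (2 / π) ^ (2 * d + 4)) * ∑ μ, ∑ ν, ‖f μ ν‖ ^ 2
      = (2 / π) ^ (2 * d) * ((2 / π) ^ 4 * ∑ μ, ∑ ν, ‖f μ ν‖ ^ 2) := by rw [pow_add]; ring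
    _ ≤ ‖u‖ ^ 2 * ∑ μ, ∑ ν, ‖f μ ν / (v μ * v ν)‖ ^ 2 :=
        mul_le_mul hu2 hsum (by positivity) (by positivity)

/-- **(7.1.30)** for the τ₀(p) of (7.1.14)/(7.1.28) itself, PROVED: ε‖f‖² ≤ ⟨f, τ₀(p)f⟩ with ε = ½(2/π)^{2d+4} for every
two-form f ∈ (∂𝒦(p))^⊥, 0 < |p_i| ≤ π, 0 < η ≤ 1 (curls with the unit-lattice symbol ∂^{(1)}(p) of (7.1.5)).
[cite: BalabanImbrieJaffe1985, (7.1.30) p.325] -/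
theorem ineq7130 {η : ℝ} (hη0 : 0 < η) (hη1 : η ≤ 1) {p : Fin d → ℝ} (hp0 : ∀ μ, p μ ≠ 0) (hp : ∀ μ, |p μ| ≤ π)
    {f : Fin d → Fin d → ℂ} (hf : IsTwoForm f) (hperp : PerpCurl (dOne p) (vSym η p) f) :
    eps730 d * normSq f ≤ (tensorInner f (tau0 η p) f).re := by
  have hd1 : dOne p = fun μ => vSym η p μ * dSym η p μ := by
    funext μ; exact dOne_eq_vSym_mul_dSym hη0 hη1 (hp0 μ) (hp μ)
  rw [hd1] at hperp
  have h := ineq7130_of_bounds (fun μ => norm_vSym_bounds hη0 hη1 (hp0 μ) (hp μ)) (norm_uSym_bounds hη0 hη1 hp0 hp).1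
    hf hperp
  have h12 : (1 / 2 : ℂ) = ((1 / 2 : ℝ) : ℂ) := by norm_num
  rw [tensorInner_tau0, tau1Term_eq_lKernel, h12, Complex.re_ofReal_mul]
  linarith

end

end Literature.MathematicalPhysics.QuantumFieldTheory.BalabanImbrieJaffe1984to88.BIJ85Tau0Positivity729
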